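import Literature.MathematicalPhysics.QuantumFieldTheory.Balaban1983to89.B5G183RatePieces

/-!
# Bałaban [CMP 95 (1984)] (1.83)/(1.89) at `U = 1`: the DIAGONAL PIECE of the order-two eta-rate in
the currency `W∂_ν ⊗ W∂_{ν′}` (ONE King weight per derivative) has the full rate `γ = 1`

HONEST FRAMING (cell `pub-balaban`, T⁴ programme, estimate NE2 = U1a «η-rate, linear theory»).  Finite
torus, lattice spacing `η = 1/n`, trivial background `U = 1`, one nonzero reduced momentum `p′ = s` at a
time, `ℓ²`-operator norm on the alias classes `× Fin d`.  Nothing here is about infinite volume, `U ≠ 1`,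
a mass gap, or any summit statement.  Bałaban prints NO rate; the currency, King's pairing `ι`/`plant`
and every constant are OURS ([folklore]).

WHAT IS PRINTED.  [Balaban1984PropagatorsI] p. 33: «Proposition 1.1. The operator G is a symmetric
operator on L²(T_η) and ‖GJ‖, ‖∇GJ‖, ‖G∇*J‖, ‖∇G∇*J‖, ‖∇∇GJ‖, ‖G∇*∇*J‖ ≤ γ₀⁻¹‖J‖, (1.89)»; p. 32
(1.87): the `l′ = l` cancellation giving the zone-centre diagonal `(1 + aS₁(μ))/(φ_μ Δ(p′))`
(`B5G183Rate.dZ`).  [King1986] p. 672: «To analyze the m = 0 term in (4.19), we successively replace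
each factor by the corresponding one … and bound the error.», (4.20) `|u(p′+l)| ≤ Π_μ |p′_μ||p′_μ + l_μ|⁻¹`
(the alias weight `W = Wc`).  (renders ref1 p016/p017, king p024 read as images by this seat.)

WHAT THIS MODULE PROVES (kernel, [folklore]).  Of the FIVE piece differences into which
`B5G183RatePieces.residual_eq_pieces` splits the typed residual
`B5G183RateO2Op.OrderTwoOpRateResidualW1` (`D_{W∂ν} G^{(RN)} D_{W∂ν′}^* − plant_R(D_{W∂ν} G^{(N)} D_{W∂ν′}^*)`),
the FIRST — b05's diagonal piece `dg` (free diagonal `W²∂_ν∂̄_{ν′}/Δ` off the zone centre, the (1.87)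
entry `W²∂_ν∂̄_{ν′}·dZ_μ` at the centre) — is `O(1/N)` in operator norm, uniformly in `p′`:
 §1 `dg_w1_offcentre` (off the centre the entry is `Wc²·w2`, `B5G183RateO2Diag.w2`), `dg_w1_centre`
    (at the centre it is `W∂_ν(p′)·conj W∂_{ν′}(p′)·dZ^{(n)}_μ(p′)`);
 §2 `centre_diff_le`: the centre entry difference between the levels `RN` and `N` is `≤ Ccen/N`
    (`dZ` is uniformly bounded, `B5G183Rate.dZ_bounds`, and has the rate `Cdz/N²`, `B5G183Rate.dZ_rate'`;
    the weights `|W∂| ≤ π` have the paired rate `6π²/N`);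
 §3 **`opNorm_dg_piece_W1_le`**: `‖diagonal(dg^{(RN)}) − diagonal(extP dg^{(N)})‖ ≤ CdgW1(d,a)/N` —
    paired off-centre classes by `B5G183RateO2Diag.diag_weight2_rate_le` (this is where ONE weight per
    derivative is exactly what the free diagonal needs: `W²·‖q̃‖·(6‖q̃‖²/N)/‖q̃‖² = 6W²‖q̃‖/N ≤ 6π/N`),
    unpaired classes by `diag_weight2_unpaired_le` (`Wc² ≤ N⁻²` there), the centre by §2.

WHAT REMAINS / NOT CLAIMED: the four FINITE-RANK piece differences (b05's blocks `R`, `C1`, `C2` and the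
rank-one `T`) of the `W∂ ⊗ W∂` residual — `OrderTwoOpRateResidualW1` itself stays OPEN (typed in
`B5G183RateO2Op`, not proved, not assumed); nothing about print.
-/

noncomputable section

namespace Literature.MathematicalPhysics.QuantumFieldTheory.Balaban1983to89.B5G183RateW1Diag

open scoped BigOperators ComplexConjugate Matrix.Norms.L2Operator
open Finset Complex
open Literature.MathematicalPhysics.QuantumFieldTheory.Balaban1983to89.B4Strip
open Literature.MathematicalPhysics.QuantumFieldTheory.Balaban1983to89.B5Prop11Fiber
open Literature.MathematicalPhysics.QuantumFieldTheory.Balaban1983to89.B5Prop11Bound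
open Literature.MathematicalPhysics.QuantumFieldTheory.Balaban1983to89.B5Hk163Rate
open Literature.MathematicalPhysics.QuantumFieldTheory.Balaban1983to89.B5Hk163RateSum
open Literature.MathematicalPhysics.QuantumFieldTheory.Balaban1983to89.B5G183Rate
open Literature.MathematicalPhysics.QuantumFieldTheory.Balaban1983to89.B5G183RateSum
open Literature.MathematicalPhysics.QuantumFieldTheory.Balaban1983to89.B5G183RateOp
open Literature.MathematicalPhysics.QuantumFieldTheory.Balaban1983to89.B5G183RateO2Diag
open Literature.MathematicalPhysics.QuantumFieldTheory.Balaban1983to89.B5G183RateO2Op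
open Literature.MathematicalPhysics.QuantumFieldTheory.Balaban1983to89.B5G183RatePieces
open Literature.MathematicalPhysics.QuantumFieldTheory.King1986

variable {d : ℕ}

/-! ## §1 The entries of b05's diagonal piece of Bałaban's fibre in the currency `W∂ ⊗ W∂` [folklore] -/

section Entries

variable {n : ℕ} [NeZero n]

/-- the zone centre of Bałaban's fibre is the zero class. [folklore] -/
theorem balabanFiber_o (hn : 1 ≤ n) (a : ℝ) (ha : 0 < a) {s : Fin d → ℝ}
    (hs : ∀ ν, |s ν| ≤ Real.pi) (hs0 : s ≠ 0) : (balabanFiber n hn a ha s hs hs0).o = 0 := rfl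

/-- **off the centre** the `W∂_ν ⊗ W∂_{ν′}` diagonal entry of (1.83) is `Wc²·∂_ν conj ∂_{ν′}·Δ⁻¹ = Wc²·w2`
(`B5Hk163Rate.IsRep.DeltaXir_eq` moves b05's `Δ(p′ + l)` to the symmetric representative).
[cite: Balaban1984PropagatorsI, (1.83) p.31] [folklore] -/
theorem dg_w1_offcentre (hn : 1 ≤ n) (a : ℝ) (ha : 0 < a) {s : Fin d → ℝ}
    (hs : ∀ ν, |s ν| ≤ Real.pi) (hs0 : s ≠ 0) {K : Fin d → Fin n} (hK : K ≠ 0) (ν ν' μ : Fin d) :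
    (balabanFiber n hn a ha s hs hs0).dg (fun K => w1dSym n K s ν) (fun K => w1dSym n K s ν') (K, μ)
      = ((Wc n K s ^ 2 : ℝ) : ℂ) * w2 n K s ν ν' := by
  have hΔ : (balabanFiber n hn a ha s hs hs0).Δ K = DeltaXir n 0 (symmAlias n K s) := by
    show DeltaXir n 0 (shiftr n K s) = _
    exact (isRep_symmAlias hn K hs).DeltaXir_eq hn
  have hK' : K ≠ (balabanFiber n hn a ha s hs hs0).o := hK
  unfold Fiber.dg
  dsimp only
  rw [if_neg hK', hΔ]
  unfold w1dSym w2
  rw [map_mul, Complex.conj_ofReal]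
  push_cast
  ring

/-- **at the centre** the `W∂_ν ⊗ W∂_{ν′}` diagonal entry is `W∂_ν(p′)·conj W∂_{ν′}(p′)·dZ_μ(p′)` with
`dZ = (1 + aS₁(μ))/(φ_μ Δ(p′))` the (1.87) bracket (`B5G183Rate.fiber_S₁_eq`, `fiber_φ_eq`,
`fiber_Δo_eq`). [cite: Balaban1984PropagatorsI, (1.87) p.32] [folklore] -/
theorem dg_w1_centre (hn : 1 ≤ n) (a : ℝ) (ha : 0 < a) {s : Fin d → ℝ}
    (hs : ∀ ν, |s ν| ≤ Real.pi) (hs0 : s ≠ 0) (ν ν' μ : Fin d) :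
    (balabanFiber n hn a ha s hs hs0).dg (fun K => w1dSym n K s ν) (fun K => w1dSym n K s ν') (0, μ)
      = w1dSym n 0 s ν * conj (w1dSym n 0 s ν') * ((dZ n a μ s : ℝ) : ℂ) := by
  have ho : (balabanFiber n hn a ha s hs hs0).o = 0 := rfl
  have hS := fiber_S₁_eq hn a ha s hs hs0 μ
  have hφ := fiber_φ_eq hn a ha s hs hs0 μ
  have hΔ := fiber_Δo_eq hn a ha s hs hs0
  rw [ho] at hΔ
  have ha' : (balabanFiber n hn a ha s hs hs0).a = a := rfl
  unfold Fiber.dg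
  dsimp only
  rw [if_pos ho.symm, ho, hS, hφ, hΔ, ha']
  unfold dZ
  push_cast
  ring

end Entries

/-! ## §2 The centre entry difference between the levels `RN` and `N` [folklore] -/

section Centre

variable {N R : ℕ} [NeZero N] [NeZero R]

/-- the uniform bound of `dZ` (`B5G183Rate.dZ_bounds`): `(1 + a/4)/(a γ₀)`. [folklore] -/
def DZ (d : ℕ) (a : ℝ) : ℝ := (1 + a / 4) / (a * T4GaugeActionRate.gam0 d)

/-- constant of the centre difference: `12π³·DZ + π²·Cdz`. [folklore] -/
def Ccen (d : ℕ) (a : ℝ) : ℝ := 12 * Real.pi ^ 3 * DZ d a + Real.pi ^ 2 * Cdz d a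

omit [NeZero N] [NeZero R] in
/-- `0 ≤ DZ`, `0 ≤ Ccen`. [folklore] -/
theorem Ccen_nonneg (d : ℕ) {a : ℝ} (ha : 0 < a) : 0 ≤ DZ d a ∧ 0 ≤ Ccen d a := by
  have hg := T4GaugeActionRate.gam0_pos d
  have h1 : 0 ≤ DZ d a := by unfold DZ; positivity
  have h2 := (Cdz_nonneg d ha).1
  exact ⟨h1, by unfold Ccen; positivity⟩

omit [NeZero R] in
/-- `‖p′‖_∞ ≤ π` on the zone, hence `‖q̃_0‖ = ‖p′‖ ≤ π`. [folklore] -/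
theorem norm_symmAlias_zero_le (hN : 1 ≤ N) {s : Fin d → ℝ} (hs : ∀ ν, |s ν| ≤ Real.pi) :
    ‖symmAlias N (0 : Fin d → Fin N) s‖ ≤ Real.pi := by
  rw [symmAlias_zero hN hs]
  exact (pi_norm_le_iff_of_nonneg Real.pi_pos.le).mpr fun ν => by
    rw [Real.norm_eq_abs]; exact hs ν

/-- **the centre entry difference:** `‖W∂^{(RN)}_ν conj W∂^{(RN)}_{ν′} dZ^{(RN)}_μ − W∂^{(N)}_ν conj
W∂^{(N)}_{ν′} dZ^{(N)}_μ‖(p′) ≤ Ccen/N` — three-term split (`B5G183RateO2Diag.norm_three_split_le`) with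
`|W∂| ≤ π` (`norm_w1dSym_le`), the paired weight rate `6‖q̃_0‖²/N ≤ 6π²/N` at the centre
(`B5G183RatePieces.w1dSym_weight_hyps`, `iota_zero`), `0 < dZ ≤ DZ` (`dZ_bounds`) and
`|dZ^{(N)} − dZ^{(RN)}| ≤ Cdz/N²` (`dZ_rate'`). [cite: King1986, (4.20)–(4.21) p.672;
Balaban1984PropagatorsI, (1.87) p.32] [folklore] -/
theorem centre_diff_le (hN : 1 ≤ N) (hR : 1 ≤ R) (a : ℝ) (ha : 0 < a) {s : Fin d → ℝ}
    (hs : ∀ ν, |s ν| ≤ Real.pi) (hs0 : s ≠ 0) (ν ν' μ : Fin d) :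
    ‖w1dSym (R * N) 0 s ν * conj (w1dSym (R * N) 0 s ν') * ((dZ (R * N) a μ s : ℝ) : ℂ)
        - w1dSym N 0 s ν * conj (w1dSym N 0 s ν') * ((dZ N a μ s : ℝ) : ℂ)‖
      ≤ Ccen d a / N := by
  obtain ⟨ν₀, hν₀⟩ : ∃ ν, s ν ≠ 0 := Function.ne_iff.mp hs0
  have hπ := Real.pi_pos
  have hN0 : (0 : ℝ) < N := by exact_mod_cast hN
  have hN1 : (1 : ℝ) ≤ N := by exact_mod_cast hN
  have hRN : 1 ≤ R * N := one_le_RN hN hR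
  have hDZ := (Ccen_nonneg d ha).1
  have hCdz := (Cdz_nonneg d ha).1
  -- weights: size and paired rate at the centre
  have hwgt := w1dSym_weight_hyps (N := N) (R := R) hN hR hs
  have hq0 : ‖symmAlias N (0 : Fin d → Fin N) s‖ ≤ Real.pi := norm_symmAlias_zero_le hN hs
  have hrate : ∀ l : Fin d, ‖w1dSym (R * N) 0 s l - w1dSym N 0 s l‖ ≤ 6 * Real.pi ^ 2 / N := by
    intro l
    have h := (hwgt l).2 0
    rw [iota_zero hN hs] at h
    refine h.trans ?_
    have : ‖symmAlias N (0 : Fin d → Fin N) s‖ ^ 2 ≤ Real.pi ^ 2 :=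
      pow_le_pow_left₀ (norm_nonneg _) hq0 2
    gcongr
  have hA : ‖w1dSym (R * N) 0 s ν - w1dSym N 0 s ν‖ ≤ 6 * Real.pi ^ 2 / N := hrate ν
  have hB : ‖conj (w1dSym (R * N) 0 s ν') - conj (w1dSym N 0 s ν')‖ ≤ 6 * Real.pi ^ 2 / N := by
    rw [← map_sub, Complex.norm_conj]; exact hrate ν'
  have hBn : ‖conj (w1dSym (R * N) 0 s ν')‖ ≤ Real.pi := by
    rw [Complex.norm_conj]; exact norm_w1dSym_le hRN 0 hs ν'
  have hA0 : ‖w1dSym N 0 s ν‖ ≤ Real.pi := norm_w1dSym_le hN 0 hs ν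
  have hB0 : ‖conj (w1dSym N 0 s ν')‖ ≤ Real.pi := by
    rw [Complex.norm_conj]; exact norm_w1dSym_le hN 0 hs ν'
  -- dZ: size and rate
  have hz := dZ_bounds hRN a ha μ hs ν₀ hν₀
  have ha1 : |dZ (R * N) a μ s| ≤ DZ d a := by
    rw [abs_of_pos hz.1]; exact hz.2
  have ha2 : |dZ (R * N) a μ s - dZ N a μ s| ≤ Cdz d a / N := by
    rw [abs_sub_comm]
    calc _ ≤ Cdz d a * ((N : ℝ) ^ 2)⁻¹ := dZ_rate' hN hR a ha μ hs ν₀ hν₀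
      _ ≤ Cdz d a / N := by
          rw [← div_eq_mul_inv]
          exact div_le_div_of_nonneg_left hCdz hN0 (by nlinarith)
  calc _ ≤ ‖w1dSym (R * N) 0 s ν - w1dSym N 0 s ν‖ * ‖conj (w1dSym (R * N) 0 s ν')‖
            * |dZ (R * N) a μ s|
          + ‖w1dSym N 0 s ν‖ * ‖conj (w1dSym (R * N) 0 s ν') - conj (w1dSym N 0 s ν')‖
            * |dZ (R * N) a μ s|
          + ‖w1dSym N 0 s ν‖ * ‖conj (w1dSym N 0 s ν')‖ * |dZ (R * N) a μ s - dZ N a μ s| :=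
        norm_three_split_le _ _ _ _ _ _
    _ ≤ 6 * Real.pi ^ 2 / N * Real.pi * DZ d a + Real.pi * (6 * Real.pi ^ 2 / N) * DZ d a
          + Real.pi * Real.pi * (Cdz d a / N) := by
        gcongr
    _ = Ccen d a / N := by unfold Ccen; field_simp; ring

end Centre

/-! ## §3 The diagonal piece of the `W∂ ⊗ W∂` residual is `O(1/N)` [folklore] -/

section Main

variable {N R : ℕ} [NeZero N] [NeZero R]

/-- constant of the diagonal piece: `Cdg2 + π²/4 + Ccen`. [folklore] -/
def CdgW1 (d : ℕ) (a : ℝ) : ℝ := Cdg2 + Real.pi ^ 2 / 4 + Ccen d a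

omit [NeZero N] [NeZero R] in
/-- `0 ≤ CdgW1`. [folklore] -/
theorem CdgW1_nonneg (d : ℕ) {a : ℝ} (ha : 0 < a) : 0 ≤ CdgW1 d a := by
  have h1 := Cdg2_nonneg
  have h2 := (Ccen_nonneg d ha).2
  unfold CdgW1; positivity

/-- **entrywise bound of the diagonal piece difference:** for every class `K` of level `RN` and every
component `μ`, `‖dg^{(RN)}(K, μ) − (extP dg^{(N)})(K, μ)‖ ≤ CdgW1/N` — King's `m = 0` classes `K = ιk`
off the centre (`diag_weight2_rate_le`), the centre `ι0 = 0` (`centre_diff_le`), and the `|m| ≥ 1`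
classes where the planted piece vanishes (`diag_weight2_unpaired_le`).
[cite: King1986, (4.19)–(4.20), (4.23) p.672; Balaban1984PropagatorsI, (1.87) p.32, Prop. 1.1 (1.89)
p.33] [folklore] -/
theorem dg_entry_diff_le (hN : 1 ≤ N) (hR : 1 ≤ R) (hRN : 1 ≤ R * N) (a : ℝ) (ha : 0 < a)
    {s : Fin d → ℝ} (hs : ∀ ν, |s ν| ≤ Real.pi) (hs0 : s ≠ 0) (ν ν' : Fin d)
    (I : (Fin d → Fin (R * N)) × Fin d) :
    ‖(balabanFiber (R * N) hRN a ha s hs hs0).dg (fun K => w1dSym (R * N) K s ν)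
          (fun K => w1dSym (R * N) K s ν') I
        - extP R s ((balabanFiber N hN a ha s hs hs0).dg (fun k => w1dSym N k s ν)
          (fun k => w1dSym N k s ν')) I‖
      ≤ CdgW1 d a / N := by
  obtain ⟨ν₀, hν₀⟩ : ∃ ν, s ν ≠ 0 := Function.ne_iff.mp hs0
  obtain ⟨K, μ⟩ := I
  have hπ := Real.pi_pos
  have hN0 : (0 : ℝ) < N := by exact_mod_cast hN
  have hN1 : (1 : ℝ) ≤ N := by exact_mod_cast hN
  have hC2 := Cdg2_nonneg
  have hCc := (Ccen_nonneg d ha).2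
  by_cases hp : ∃ k : Fin d → Fin N, iota R k s = K
  · obtain ⟨k, rfl⟩ := hp
    rw [extP_iota hN hs]
    by_cases hk : k = 0
    · -- the centre
      subst hk
      rw [iota_zero hN hs, dg_w1_centre hRN a ha hs hs0 ν ν' μ, dg_w1_centre hN a ha hs hs0 ν ν' μ]
      calc _ ≤ Ccen d a / N := centre_diff_le hN hR a ha hs hs0 ν ν' μ
        _ ≤ CdgW1 d a / N := by
            gcongr; unfold CdgW1; linarith [sq_nonneg Real.pi]
    · -- paired, off the centre
      have hK : iota R k s ≠ 0 := fun h =>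
        hk (iota_injective hN hs (h.trans (iota_zero hN hs).symm))
      rw [dg_w1_offcentre hRN a ha hs hs0 hK ν ν' μ, dg_w1_offcentre hN a ha hs hs0 hk ν ν' μ,
        Wc_iota hN k hs, ← mul_sub, norm_mul, Complex.norm_real, Real.norm_eq_abs,
        abs_of_nonneg (sq_nonneg _)]
      calc _ ≤ Cdg2 / N := diag_weight2_rate_le hN hR hs ν₀ hν₀ k ν ν'
        _ ≤ CdgW1 d a / N := by
            gcongr; unfold CdgW1; linarith [sq_nonneg Real.pi]
  · -- unpaired: the planted piece vanishes
    push Not at hp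
    have hK : K ≠ 0 := fun h => hp 0 ((iota_zero hN hs).trans h.symm)
    rw [extP_unpaired _ hp, sub_zero, dg_w1_offcentre hRN a ha hs hs0 hK ν ν' μ, norm_mul,
      Complex.norm_real, Real.norm_eq_abs, abs_of_nonneg (sq_nonneg _)]
    calc _ ≤ Real.pi ^ 2 / 4 / (N : ℝ) ^ 2 := diag_weight2_unpaired_le hN hR hs hp ν ν'
      _ ≤ Real.pi ^ 2 / 4 / N := by
          apply div_le_div_of_nonneg_left (by positivity) hN0; nlinarith
      _ ≤ CdgW1 d a / N := by
          gcongr; unfold CdgW1; linarith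

/-- **THE DIAGONAL PIECE OF THE `W∂_ν ⊗ W∂_{ν′}` ORDER-TWO eta-RATE IS `O(1/N)`:** for `N, R ≥ 1`,
`a > 0`, a nonzero reduced momentum `p′ = s` of the zone and directions `ν, ν′`,
`‖diagonal(dg^{(RN)}_{W∂ν,W∂ν′}) − diagonal(extP_R dg^{(N)}_{W∂ν,W∂ν′})‖_(ℓ²→ℓ²) ≤ CdgW1(d,a)/N` — the first
of the five piece differences of `B5G183RatePieces.residualW1_le_pieces`, with the FULL rate `γ = 1`
and ONE King weight per derivative. (The four finite-rank piece differences remain.)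
[cite: Balaban1984PropagatorsI, (1.83) p.31, (1.87) p.32, Prop. 1.1 (1.89) p.33; King1986,
(4.19)–(4.20), (4.23) p.672, (4.24) p.673] [folklore] -/
theorem opNorm_dg_piece_W1_le (hN : 1 ≤ N) (hR : 1 ≤ R) (hRN : 1 ≤ R * N) (a : ℝ) (ha : 0 < a)
    {s : Fin d → ℝ} (hs : ∀ ν, |s ν| ≤ Real.pi) (hs0 : s ≠ 0) (ν ν' : Fin d) :
    ‖Matrix.diagonal ((balabanFiber (R * N) hRN a ha s hs hs0).dg (fun K => w1dSym (R * N) K s ν)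
          (fun K => w1dSym (R * N) K s ν'))
        - Matrix.diagonal (extP R s ((balabanFiber N hN a ha s hs hs0).dg
          (fun k => w1dSym N k s ν) (fun k => w1dSym N k s ν')))‖
      ≤ CdgW1 d a / N := by
  have hN0 : (0 : ℝ) < N := by exact_mod_cast hN
  exact opNorm_diagonal_sub_le _ _ (div_nonneg (CdgW1_nonneg d ha) hN0.le)
    fun I => dg_entry_diff_le hN hR hRN a ha hs hs0 ν ν' I

/-- **consequence for the typed residual:** the `W∂ ⊗ W∂` residual is bounded by `CdgW1/N` plus the four
FINITE-RANK piece differences (b05's blocks `R`, `C1`, `C2` and the rank-one `T`).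
[cite: Balaban1984PropagatorsI, Prop. 1.1 (1.89) p.33; King1986, (4.19) p.672] [folklore] -/
theorem residualW1_le_diag_add_finiteRank (hN : 1 ≤ N) (hR : 1 ≤ R) (hRN : 1 ≤ R * N) (a : ℝ)
    (ha : 0 < a) {s : Fin d → ℝ} (hs : ∀ ν, |s ν| ≤ Real.pi) (hs0 : s ≠ 0) (ν ν' : Fin d) :
    let F := balabanFiber (R * N) hRN a ha s hs hs0
    let F' := balabanFiber N hN a ha s hs hs0
    let wa : (Fin d → Fin (R * N)) → ℂ := fun K => w1dSym (R * N) K s ν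
    let wb : (Fin d → Fin (R * N)) → ℂ := fun K => w1dSym (R * N) K s ν'
    let wa' : (Fin d → Fin N) → ℂ := fun k => w1dSym N k s ν
    let wb' : (Fin d → Fin N) → ℂ := fun k => w1dSym N k s ν'
    ‖sandwich wa wb F.G - plant R s (sandwich wa' wb' F'.G)‖
      ≤ CdgW1 d a / N
        + ‖blockR F.cR (F.xw wa) (F.xw wb) - blockR F'.cR (extV R s (F'.xw wa')) (extV R s (F'.xw wb'))‖
        + ‖blockR F.cR (F.xo wa) (F.xw wb) - blockR F'.cR (extV R s (F'.xo wa')) (extV R s (F'.xw wb'))‖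
        + ‖blockR F.cR (F.xw wa) (F.xo wb) - blockR F'.cR (extV R s (F'.xw wa')) (extV R s (F'.xo wb'))‖
        + ‖rankOne F.cT (F.bw wa) (F.bw wb)
            - rankOne F'.cT (extP R s (F'.bw wa')) (extP R s (F'.bw wb'))‖ := by
  have h1 := residualW1_le_pieces (N := N) (R := R) hN hRN a ha hs hs0 ν ν'
  have h2 := opNorm_dg_piece_W1_le hN hR hRN a ha hs hs0 ν ν'
  dsimp only at h1 ⊢
  linarith

end Main

end Literature.MathematicalPhysics.QuantumFieldTheory.Balaban1983to89.B5G183RateW1Diag
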